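import Summits.AnomalousDissipation.AnomalousDissipation.Theorems.DopplerClockLongitudinalClassQuietModes
import Summits.AnomalousDissipation.AnomalousDissipation.Theorems.DopplerClockLongitudinalClassQuietCrossPlane
import Summits.AnomalousDissipation.AnomalousDissipation.Theorems.DopplerClockForceAdmissible
import Summits.AnomalousDissipation.AnomalousDissipation.Theorems.TwodBoundedEnergyZeroMomentum.Negative.FirstShellRigidity
import Literature.Analysis.FluidPDE.TorusClassicalLerayHopfProofs
import Literature.Analysis.FluidPDE.DoeringFoiasProofs

/-!
# Route DopplerClock (AnomalousDissipation) — support item `LongitudinalClassQuiet`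
# (stmt-AnomalousDissipation-18134): the `x₀`-invariant class of the swept Doppler pair is quiet

For `f = F sin(2πm x₁) cos(2πn x₂) e₀`, `V, ν > 0`, `n ≥ 1`, every classical solution `(u, p)` of
`NS_ν` on `[0, ∞) × T³` forced by `f` which is invariant under all translations along the
`x₀`-circle, has momentum `∫ u(0) = V e₂` and bounded kinetic energy satisfies
`⟨ν ‖∇u‖₂²⟩ ≤ ν κ² F² / (4 V² (2πn)²)`, `κ² = 4π²(m² + n²)` — the laminar (streak) value.

**Proof** (`longitudinalClassQuiet_proof`).
1. *Dissipation ≤ injection.* The solution is a global Leray–Hopf solution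
   (`Torus.IsClassicalNSSolutionOn.isLerayHopfOn_of_convex`), so `⟨ν‖∇u‖²⟩ ≤ ⟨(f, u)⟩`
   (`DoeringFoias2002_dissipation_le_power_holds`), and `(f, u(t)) = F · A(t)` with the streak
   amplitudes `A = (u, Ψ_c)`, `B = (u, Ψ_s)`, `Ψ_c = sin cos e₀`, `Ψ_s = sin sin e₀`.
2. *The amplitude system.* Testing the momentum equation with `Ψ_c`, `Ψ_s`
   (`Torus.IsClassicalNSSolutionOn.hasDerivWithinAt_integral_inner`; `ΔΨ = −κ²Ψ`,
   `(f, Ψ_c) = F/4 (1 − [m = 0])`, `(f, Ψ_s) = 0`, `∂₂Ψ_c = −2πn Ψ_s`, `∂₂Ψ_s = 2πn Ψ_c`, and the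
   Galilean split `⟪u,(u·∇)Ψ⟫ = ⟪w,(w·∇)Ψ⟫ + V⟪u,∂₂Ψ⟫`, `w = u − V e₂`,
   `GridInjection.integral_inner_convect_eq_shift`) gives on `[0, ∞)`
   `A' = e₁ − νκ²A − ωB + (f, Ψ_c)`, `B' = e₂ + ωA − νκ²B`, `ω = 2πnV`, with the fluctuation
   stresses `eᵢ = ∫ ⟪w, (w·∇)Ψᵢ⟫`.
3. *The stresses die out.* `|eᵢ(t)| ≤ Kᵢ ‖w(t)‖₂ ‖u(t) − u₀(t) e₀ − V e₂‖₂`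
   (`exists_abs_integral_inner_convect_le`: an `x₀`-independent pattern only feels the cross-plane
   components), `‖w(t)‖₂` is bounded by the energy bound, and the cross-plane energy
   `∫ ‖u − u₀ e₀ − V e₂‖² → 0` (`tendsto_crossPlaneEnergy_zero`: it solves the unforced planar
   energy identity — here the `x₀`-invariance is used — with Poincaré decay; the momentum stays
   `V e₂` by `Torus.IsGlobalLerayHopf.integral_inner_const_eq`).
4. *Conclusion.* By `tendsto_of_damped_rotation`, `A(t) → (f,Ψ_c) νκ²/(ν²κ⁴ + ω²)`, so the Cesàro
   means of the injection converge (`longTimeAvgSup_eq_of_tendsto`) and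
   `⟨ν‖∇u‖²⟩ ≤ F (f,Ψ_c) νκ²/(ν²κ⁴ + ω²) ≤ νκ²F²/(4ω²)`.

References: Foias–Manley–Rosa–Temam 2001, Ch. II (momentum, Galilean frames) and Ch. IV §3.1;
Doering–Foias 2002, §2; Alexakis–Doering 2006, §2 (planar energy method); Marchioro 1986
(laminar attraction by the energy method). No new definitions.
-/

noncomputable section

-- `Summit.<Summit>.<Problem>` is the tree's mandated summit-side namespace (CONVENTIONS §2); for this
-- single-conjunct summit the two coincide, so the duplicate is deliberate.
set_option linter.dupNamespace false

open MeasureTheory Set Filter Topology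
open scoped InnerProductSpace RealInnerProductSpace

namespace Summit.AnomalousDissipation.AnomalousDissipation.Theorems

open Literature.Analysis.FluidPDE Literature.Analysis.FluidPDE.Torus
open Literature.Analysis.FunctionSpaces Literature.Analysis.FunctionSpaces.Torus

namespace LongitudinalQuiet

/-! ### Small pointwise facts -/

/-- `(v − V e₂) − (v − V e₂)₀ e₀ = v − v₀ e₀ − V e₂` (`(e₂)₀ = 0`). [folklore] -/
theorem galilean_crossPlane (v : EuclideanSpace ℝ (Fin 3)) (V : ℝ) :
    v - V • EuclideanSpace.single (2 : Fin 3) (1 : ℝ) -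
        ((v - V • EuclideanSpace.single (2 : Fin 3) (1 : ℝ)) 0) •
          EuclideanSpace.single (0 : Fin 3) (1 : ℝ) =
      v - (v 0) • EuclideanSpace.single (0 : Fin 3) (1 : ℝ) - V • EuclideanSpace.single (2 : Fin 3) (1 : ℝ) := by
  have h0 : (v - V • EuclideanSpace.single (2 : Fin 3) (1 : ℝ)) 0 = v 0 := by
    simp
  rw [h0]
  abel

/-- `‖a − b‖² ≤ 2‖a‖² + 2‖b‖²`. [folklore] -/
theorem norm_sub_sq_le_two_mul (a b : EuclideanSpace ℝ (Fin 3)) :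
    ‖a - b‖ ^ 2 ≤ 2 * ‖a‖ ^ 2 + 2 * ‖b‖ ^ 2 := by
  have h := norm_sub_le a b
  nlinarith [h, norm_nonneg (a - b), norm_nonneg a, norm_nonneg b, sq_nonneg (‖a‖ - ‖b‖)]

/-- Characters with vanishing `0`-th frequency are invariant under `x₀`-translations, hence so are
the patterns `(Im e_M · Re e_N) a` (`M₀ = N₀ = 0`). [folklore] -/
theorem copattern_add_single {M N : Fin 3 → ℤ} (hM : M 0 = 0) (hN : N 0 = 0)
    (a : EuclideanSpace ℝ (Fin 3)) (s : UnitAddCircle) (y : UnitAddTorus (Fin 3)) :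
    (fun y : UnitAddTorus (Fin 3) =>
        ((UnitAddTorus.mFourier M y).im * (UnitAddTorus.mFourier N y).re) • a) (y + Pi.single 0 s) =
      (fun y : UnitAddTorus (Fin 3) =>
        ((UnitAddTorus.mFourier M y).im * (UnitAddTorus.mFourier N y).re) • a) y := by
  simp only [AcdcDesign.mFourier_add_single_of_apply_eq_zero hM,
    AcdcDesign.mFourier_add_single_of_apply_eq_zero hN]

/-- The same for the quadrature patterns `(Im e_M · Im e_N) a`. [folklore] -/
theorem pattern_add_single {M N : Fin 3 → ℤ} (hM : M 0 = 0) (hN : N 0 = 0)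
    (a : EuclideanSpace ℝ (Fin 3)) (s : UnitAddCircle) (y : UnitAddTorus (Fin 3)) :
    (fun y : UnitAddTorus (Fin 3) =>
        ((UnitAddTorus.mFourier M y).im * (UnitAddTorus.mFourier N y).im) • a) (y + Pi.single 0 s) =
      (fun y : UnitAddTorus (Fin 3) =>
        ((UnitAddTorus.mFourier M y).im * (UnitAddTorus.mFourier N y).im) • a) y := by
  simp only [AcdcDesign.mFourier_add_single_of_apply_eq_zero hM,
    AcdcDesign.mFourier_add_single_of_apply_eq_zero hN]

end LongitudinalQuiet

open LongitudinalQuiet in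
/-- **`DopplerClock.LongitudinalClassQuiet` holds** (item stmt-AnomalousDissipation-18134): every
`x₀`-invariant classical solution on `[0, ∞)` of `NS_ν` on `T³` forced by the swept Doppler pair
`f = F sin(2πm x₁) cos(2πn x₂) e₀`, with momentum `V e₂` and bounded energy, has
`meanDissipation ν u ≤ ν · 4π²(m²+n²) · F² / (4 V² (2πn)²)`: the cross-plane field decays
(unforced planar Navier–Stokes, Poincaré), the two streak amplitudes follow a damped rotation with
vanishing stresses and converge to the laminar values, and dissipation ≤ injection = `F · (u, Ψ_c)`
in the Cesàro mean (Foias–Manley–Rosa–Temam 2001, Ch. II and IV; Doering–Foias 2002 §2;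
Alexakis–Doering 2006 §2). [folklore] -/
theorem longitudinalClassQuiet_proof :
    Summit.AnomalousDissipation.AnomalousDissipation.Theses.DopplerClock.LongitudinalClassQuiet := by
  unfold Summit.AnomalousDissipation.AnomalousDissipation.Theses.DopplerClock.LongitudinalClassQuiet
  intro F V ν m n u p hV hν hn hsol hinv hmom hE
  -- the design: force `f`, conjugate pattern `Ψc`, quadrature pattern `Ψs`
  set M : Fin 3 → ℤ := Pi.single (1 : Fin 3) (m : ℤ) with hMdef
  set N : Fin 3 → ℤ := Pi.single (2 : Fin 3) (n : ℤ) with hNdef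
  set f : UnitAddTorus (Fin 3) → EuclideanSpace ℝ (Fin 3) := fun x =>
    (F * (UnitAddTorus.mFourier M x).im * (UnitAddTorus.mFourier N x).re) •
      EuclideanSpace.single (0 : Fin 3) (1 : ℝ) with hf
  set Ψc : UnitAddTorus (Fin 3) → EuclideanSpace ℝ (Fin 3) := fun y =>
    ((UnitAddTorus.mFourier M y).im * (UnitAddTorus.mFourier N y).re) •
      EuclideanSpace.single (0 : Fin 3) (1 : ℝ) with hΨc
  set Ψs : UnitAddTorus (Fin 3) → EuclideanSpace ℝ (Fin 3) := fun y =>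
    ((UnitAddTorus.mFourier M y).im * (UnitAddTorus.mFourier N y).im) •
      EuclideanSpace.single (0 : Fin 3) (1 : ℝ) with hΨs
  set e₀ : EuclideanSpace ℝ (Fin 3) := EuclideanSpace.single (0 : Fin 3) (1 : ℝ) with he₀
  set e₂ : EuclideanSpace ℝ (Fin 3) := EuclideanSpace.single (2 : Fin 3) (1 : ℝ) with he₂
  set κ2 : ℝ := 4 * Real.pi ^ 2 * ((m : ℝ) ^ 2 + (n : ℝ) ^ 2) with hκ2
  set a : ℝ := ν * κ2 with ha
  set Om : ℝ := 2 * Real.pi * n * V with hOm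
  set c₀ : ℝ := F * (4⁻¹ * (1 - if m = 0 then 1 else 0)) with hc₀
  have hM0 : M 0 = 0 := by simp [hMdef]
  have hN0 : N 0 = 0 := by simp [hNdef]
  have hn' : (n : ℝ) ≠ 0 := by exact_mod_cast hn.ne'
  have hπ : 0 < Real.pi := Real.pi_pos
  have hκ2pos : 0 < κ2 := by
    have : (1 : ℝ) ≤ (n : ℝ) := by exact_mod_cast hn
    rw [hκ2]; positivity
  have hapos : 0 < a := mul_pos hν hκ2pos
  -- regularity of the design
  have hfs : IsSmooth f := DopplerWork.force_isSmooth F M N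
  have hf0 : HasZeroMean f := dopplerForce_hasZeroMean F M N
  obtain ⟨hΨs_s, hΨs_div, hΨs_Δ⟩ := DopplerWork.pattern_regular m n
  obtain ⟨hΨc_s, hΨc_div, hΨc_Δ⟩ := copattern_regular m n
  have hΨc_c : Continuous Ψc := hΨc_s.continuous
  have hΨs_c : Continuous Ψs := hΨs_s.continuous
  have hΨs2 : ∀ y, Ψs y 2 = 0 := fun y => DopplerWork.pattern_apply_two _ _
  have hΨc2 : ∀ y, Ψc y 2 = 0 := fun y => DopplerWork.pattern_apply_two _ _
  have hdΨs : ∀ y, partialDeriv 2 Ψs y = (fun _ : UnitAddTorus (Fin 3) => 2 * Real.pi * n) y • Ψc y :=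
    fun y => by
      simp only [hΨs, hΨc]
      rw [DopplerWork.partialDeriv_two_pattern, smul_smul]
  have hdΨc : ∀ y, partialDeriv 2 Ψc y = (fun _ : UnitAddTorus (Fin 3) => -(2 * Real.pi * n)) y • Ψs y :=
    fun y => by
      simp only [hΨs, hΨc]
      rw [partialDeriv_two_copattern, smul_smul]
  -- the solution: smoothness, global Leray–Hopf, momentum
  have hS : Convex ℝ (Ici (0 : ℝ)) := convex_Ici 0
  have hU : UniqueDiffOn ℝ (Ici (0 : ℝ)) := uniqueDiffOn_Ici 0
  have hu : IsSmoothSpaceTimeOn (Ici 0) u := hsol.smooth_velocity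
  have hut : ∀ t : ℝ, 0 ≤ t → IsSmooth (u t) := fun t ht => hu.isSmooth_slice (mem_Ici.2 ht)
  have hLH : IsGlobalLerayHopf ν (fun _ => f) (u 0) u := fun T hT =>
    hsol.isLerayHopfOn_of_convex hS hT Icc_subset_Ici_self
  have hmom' : ∀ t : ℝ, 0 ≤ t → ∫ x, u t x = V • e₂ := by
    intro t ht
    rcases eq_or_lt_of_le ht with rfl | ht'
    · exact hmom
    · have hti : Integrable (u t) volume := (hut t ht).integrable
      have h0i : Integrable (u 0) volume := (hut 0 le_rfl).integrable
      rw [← hmom]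
      refine ext_inner_left ℝ fun e => ?_
      rw [← integral_inner hti e, ← integral_inner h0i e]
      have h1 := hLH.integral_inner_const_eq hfs hf0 e ht'
      simp_rw [real_inner_comm e] at h1
      exact h1
  obtain ⟨C, hC⟩ := hE
  have hCE : ∀ t : ℝ, 0 ≤ t → ∫ x, ‖u t x‖ ^ 2 ≤ 2 * C := by
    intro t ht
    have h := hC t ht
    unfold kineticEnergy at h
    linarith
  -- Step 1: dissipation ≤ injection = `F · A`
  have hdiss : meanDissipation ν u ≤ meanPower f u :=
    DoeringFoias2002_dissipation_le_power_holds hν (hfs.memLp 2) hf0 (u 0) u hLH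
  set A : ℝ → ℝ := fun t => ∫ x, ⟪u t x, Ψc x⟫ with hA
  set B : ℝ → ℝ := fun t => ∫ x, ⟪u t x, Ψs x⟫ with hB
  have hinj : (fun t => ∫ x, ⟪f x, u t x⟫) = fun t => F * A t := by
    funext t
    simp only [hA]
    rw [← integral_const_mul]
    refine integral_congr_ae (ae_of_all _ fun x => ?_)
    simp only [hf, hΨc, real_inner_smul_left, real_inner_smul_right]
    rw [real_inner_comm]
    ring
  -- Step 2: the amplitude system on `[0, ∞)`
  set w : ℝ → UnitAddTorus (Fin 3) → EuclideanSpace ℝ (Fin 3) := fun t y => u t y - V • e₂ with hw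
  set e₁ : ℝ → ℝ := fun t => ∫ x, ⟪w t x, convect (w t) Ψc x⟫ with he₁
  set e₂' : ℝ → ℝ := fun t => ∫ x, ⟪w t x, convect (w t) Ψs x⟫ with he₂'
  have hfΨc : ∫ x, ⟪f x, Ψc x⟫ = c₀ := integral_inner_force_copattern F m hn.ne'
  have hfΨs : ∫ x, ⟪f x, Ψs x⟫ = 0 := DopplerWork.integral_inner_force_pattern F M N
  have hlapc : ∀ t, (∫ x, ⟪u t x, laplacian Ψc x⟫) = -κ2 * A t := by
    intro t
    simp only [hA]
    rw [← integral_const_mul]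
    refine integral_congr_ae (ae_of_all _ fun x => ?_)
    dsimp only
    rw [hΨc_Δ x, inner_neg_right, real_inner_smul_right]
    ring
  have hlaps : ∀ t, (∫ x, ⟪u t x, laplacian Ψs x⟫) = -κ2 * B t := by
    intro t
    simp only [hB]
    rw [← integral_const_mul]
    refine integral_congr_ae (ae_of_all _ fun x => ?_)
    dsimp only
    rw [hΨs_Δ x, inner_neg_right, real_inner_smul_right]
    ring
  have hconvc : ∀ t : ℝ, 0 ≤ t → (∫ x, ⟪u t x, convect (u t) Ψc x⟫) = e₁ t - Om * B t := by
    intro t ht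
    rw [GridInjection.integral_inner_convect_eq_shift hΨc_s hΨs_c continuous_const hΨc2 hΨs2 hdΨc V
      ((hut t ht).memLp 2), integral_const_mul]
    simp only [he₁, hw, hB, hOm]
    ring
  have hconvs : ∀ t : ℝ, 0 ≤ t → (∫ x, ⟪u t x, convect (u t) Ψs x⟫) = e₂' t + Om * A t := by
    intro t ht
    rw [GridInjection.integral_inner_convect_eq_shift hΨs_s hΨc_c continuous_const hΨs2 hΨc2 hdΨs V
      ((hut t ht).memLp 2), integral_const_mul]
    simp only [he₂', hw, hA, hOm]
    ring
  have hAd : ∀ t : ℝ, 0 ≤ t → HasDerivWithinAt A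
      ((∫ x, ⟪u t x, convect (u t) Ψc x⟫) + ν * (∫ x, ⟪u t x, laplacian Ψc x⟫) + ∫ x, ⟪f x, Ψc x⟫)
      (Ici 0) t := fun t ht =>
    hsol.hasDerivWithinAt_integral_inner hS hU hΨc_s hΨc_div (mem_Ici.2 ht)
  have hBd : ∀ t : ℝ, 0 ≤ t → HasDerivWithinAt B
      ((∫ x, ⟪u t x, convect (u t) Ψs x⟫) + ν * (∫ x, ⟪u t x, laplacian Ψs x⟫) + ∫ x, ⟪f x, Ψs x⟫)
      (Ici 0) t := fun t ht =>
    hsol.hasDerivWithinAt_integral_inner hS hU hΨs_s hΨs_div (mem_Ici.2 ht)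
  have hA' : ∀ t : ℝ, 0 ≤ t →
      (∫ x, ⟪u t x, convect (u t) Ψc x⟫) + ν * (∫ x, ⟪u t x, laplacian Ψc x⟫) + (∫ x, ⟪f x, Ψc x⟫) =
        e₁ t - a * A t - Om * B t + c₀ := by
    intro t ht
    rw [hconvc t ht, hlapc t, hfΨc, ha]
    ring
  have hB' : ∀ t : ℝ, 0 ≤ t →
      (∫ x, ⟪u t x, convect (u t) Ψs x⟫) + ν * (∫ x, ⟪u t x, laplacian Ψs x⟫) + (∫ x, ⟪f x, Ψs x⟫) =
        e₂' t + Om * A t - a * B t := by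
    intro t ht
    rw [hconvs t ht, hlaps t, hfΨs, ha]
    ring
  -- Step 3: the fluctuation stresses die out
  have hD : Tendsto (fun t => ∫ x, ‖u t x - (u t x 0) • e₀ - V • e₂‖ ^ 2) atTop (𝓝 0) := by
    refine tendsto_crossPlaneEnergy_zero hsol hν (fun t x => ?_) hinv (by simp [he₂]) hmom'
    simp [hf, he₀]
  have hwbound : ∀ t : ℝ, 0 ≤ t → ∫ x, ‖w t x‖ ^ 2 ≤ 4 * C + 2 * ‖V • e₂‖ ^ 2 := by
    intro t ht
    have hi1 : Integrable (fun x => ‖w t x‖ ^ 2) volume := ((hut t ht).sub (isSmooth_const _)).norm_sq.integrable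
    have hi2 : Integrable (fun x => 2 * ‖u t x‖ ^ 2 + 2 * ‖V • e₂‖ ^ 2) volume :=
      ((hut t ht).norm_sq.integrable.const_mul 2).add (integrable_const _)
    calc ∫ x, ‖w t x‖ ^ 2 ≤ ∫ x, (2 * ‖u t x‖ ^ 2 + 2 * ‖V • e₂‖ ^ 2) :=
          integral_mono hi1 hi2 fun x => norm_sub_sq_le_two_mul (u t x) (V • e₂)
      _ = 2 * (∫ x, ‖u t x‖ ^ 2) + 2 * ‖V • e₂‖ ^ 2 := by
          rw [integral_add ((hut t ht).norm_sq.integrable.const_mul 2) (integrable_const _),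
            integral_const_mul]
          simp
      _ ≤ 4 * C + 2 * ‖V • e₂‖ ^ 2 := by nlinarith [hCE t ht]
  have hstress : ∀ {Ψ : UnitAddTorus (Fin 3) → EuclideanSpace ℝ (Fin 3)}, IsSmooth Ψ →
      (∀ (s : UnitAddCircle) (y : UnitAddTorus (Fin 3)), Ψ (y + Pi.single 0 s) = Ψ y) →
      Tendsto (fun t => ∫ x, ⟪w t x, convect (w t) Ψ x⟫) atTop (𝓝 0) := by
    intro Ψ hΨ hΨinv
    obtain ⟨K, hK0, hK⟩ := exists_abs_integral_inner_convect_le hΨ hΨinv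
    set Mw : ℝ := 4 * C + 2 * ‖V • e₂‖ ^ 2 with hMw
    have hbound : ∀ᶠ t in atTop, |∫ x, ⟪w t x, convect (w t) Ψ x⟫| ≤
        K * Real.sqrt Mw * Real.sqrt (∫ x, ‖u t x - (u t x 0) • e₀ - V • e₂‖ ^ 2) := by
      filter_upwards [eventually_ge_atTop (0 : ℝ)] with t ht
      have hws : IsSmooth (w t) := (hut t ht).sub (isSmooth_const _)
      have h1 := hK (w t) hws
      have h2 : Real.sqrt (∫ x, ‖w t x‖ ^ 2) ≤ Real.sqrt Mw := Real.sqrt_le_sqrt (hwbound t ht)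
      have h3 : (fun x => ‖w t x - (w t x 0) • EuclideanSpace.single (0 : Fin 3) (1 : ℝ)‖ ^ 2) =
          fun x => ‖u t x - (u t x 0) • e₀ - V • e₂‖ ^ 2 := by
        funext x
        simp only [hw, he₀, he₂]
        rw [galilean_crossPlane]
      rw [h3] at h1
      calc |∫ x, ⟪w t x, convect (w t) Ψ x⟫|
          ≤ K * Real.sqrt (∫ x, ‖w t x‖ ^ 2) * Real.sqrt (∫ x, ‖u t x - (u t x 0) • e₀ - V • e₂‖ ^ 2) := h1
        _ ≤ K * Real.sqrt Mw * Real.sqrt (∫ x, ‖u t x - (u t x 0) • e₀ - V • e₂‖ ^ 2) := by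
            gcongr
    have hlim : Tendsto (fun t => K * Real.sqrt Mw *
        Real.sqrt (∫ x, ‖u t x - (u t x 0) • e₀ - V • e₂‖ ^ 2)) atTop (𝓝 0) := by
      have h := hD.sqrt
      rw [Real.sqrt_zero] at h
      simpa using h.const_mul (K * Real.sqrt Mw)
    have habs : Tendsto (fun t => |∫ x, ⟪w t x, convect (w t) Ψ x⟫|) atTop (𝓝 0) :=
      squeeze_zero' (Eventually.of_forall fun t => abs_nonneg _) hbound hlim
    exact (tendsto_zero_iff_abs_tendsto_zero _).2 habs
  have he₁0 : Tendsto e₁ atTop (𝓝 0) :=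
    hstress hΨc_s (fun s y => copattern_add_single hM0 hN0 _ s y)
  have he₂0 : Tendsto e₂' atTop (𝓝 0) :=
    hstress hΨs_s (fun s y => pattern_add_single hM0 hN0 _ s y)
  -- Step 4: the amplitudes converge, hence the injection converges in the Cesàro mean
  obtain ⟨hAlim, -⟩ := tendsto_of_damped_rotation (T₀ := 0) hapos hAd hBd hA' hB' he₁0 he₂0
  have hglim : Tendsto (fun t => ∫ x, ⟪f x, u t x⟫) atTop (𝓝 (F * (c₀ * a / (a ^ 2 + Om ^ 2)))) := by
    rw [hinj]
    exact hAlim.const_mul F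
  have hgint : ∀ T : ℝ, 0 < T → IntegrableOn (fun t => ∫ x, ⟪f x, u t x⟫) (Ioc 0 T) := by
    intro T hT
    have hcont : ContinuousOn (fun t => ∫ x, ⟪f x, u t x⟫) (Ici 0) :=
      ((isSmoothSpaceTimeOn_const hfs _).inner hu).continuousOn_integral hS
    exact ((hcont.mono Icc_subset_Ici_self).integrableOn_compact isCompact_Icc).mono_set
      Ioc_subset_Icc_self
  have hpower : meanPower f u = F * (c₀ * a / (a ^ 2 + Om ^ 2)) :=
    TwodBoundedEnergyZeroMomentum.Negative.longTimeAvgSup_eq_of_tendsto hgint hglim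
  -- Step 5: the laminar value is below the claimed bound
  have hOmpos : 0 < Om := by rw [hOm]; positivity
  have hfinal : F * (c₀ * a / (a ^ 2 + Om ^ 2)) ≤
      ν * ((2 * Real.pi) ^ 2 * ((m : ℝ) ^ 2 + (n : ℝ) ^ 2)) * F ^ 2 / (4 * V ^ 2 * (2 * Real.pi * n) ^ 2) := by
    have hrhs : ν * ((2 * Real.pi) ^ 2 * ((m : ℝ) ^ 2 + (n : ℝ) ^ 2)) * F ^ 2 /
        (4 * V ^ 2 * (2 * Real.pi * n) ^ 2) = a * F ^ 2 / (4 * Om ^ 2) := by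
      rw [ha, hκ2, hOm]
      ring
    rw [hrhs]
    have hD1 : 0 < a ^ 2 + Om ^ 2 := by positivity
    have hD2 : 0 < 4 * Om ^ 2 := by positivity
    by_cases hm : m = 0
    · have : c₀ = 0 := by rw [hc₀, if_pos hm]; ring
      rw [this]
      simp only [zero_mul, zero_div, mul_zero]
      positivity
    · have : c₀ = F / 4 := by rw [hc₀, if_neg hm]; ring
      rw [this]
      have heq : F * (F / 4 * a / (a ^ 2 + Om ^ 2)) = a * F ^ 2 / (4 * (a ^ 2 + Om ^ 2)) := by
        field_simp
      rw [heq]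
      exact div_le_div_of_nonneg_left (by positivity) hD2 (by nlinarith [sq_nonneg a])
  calc meanDissipation ν u ≤ meanPower f u := hdiss
    _ = F * (c₀ * a / (a ^ 2 + Om ^ 2)) := hpower
    _ ≤ _ := hfinal

end Summit.AnomalousDissipation.AnomalousDissipation.Theorems

end
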